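/-
Copyright: b2b-lace packet (Lean typing seat 1, gen 14).  [FvdH17] Appendix B, Tables "Diagrams and definition of
`B^{(2),ι,a,b}(0,v,x,y)`" and "Diagram of the different cases of `B̄^{(2),ι,a,b}(0,v,x,y)`" (+ continued)
(arXiv:1506.07977v2 pp. 76–77): the two DOUBLE NON-TRIVIAL TRIANGLES, typed as definitions over the letter bundle
of `NobleBlocks`, and plugged into the composites `B^{ι,a,b}`, `B̄^{ι,a,b}` of (5.4)–(5.5).  Definitions and kernel
lemmas only; no named fact; no numeral; no dimension is fixed.
-/
import Literature.Probability.FitznerVanDerHofstad2017.NobleBlocks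
import HarnessLib

/-!
# [FvdH17] Appendix B: the double non-trivial triangles `B^{(2),ι,a,b}` and `B̄^{(2),ι,a,b}`, typed

Source: R. Fitzner, R. van der Hofstad, *Mean-field behavior for nearest-neighbor percolation in `d > 10`*,
Electron. J. Probab. **22** (2017) no. 43 [FvdH17]; page numbers are those of the extended version
arXiv:1506.07977v2, "TeX l." refers to the lines of its LaTeX source `PercPaper_arxiv2017.tex`.

`NobleBlocks` types the §5.1 / App. B building blocks `P^{S,b}`, `P^{E,b}`, `P^{ι,b}`, `A^{a,b}`, `A^{ι,a,b}`,
`Ā^{ι,a,b}` (and starred twins) and the composites (5.4)–(5.5)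
`B^{ι,a,b} = Σ_c A^{ι,a,c,*} A^{c,b} + A^{ι,a,b} P^{0} + B^{(2),ι,a,b}`,
`B̄^{ι,a,b} = Σ_c A^{ι,a,c} A^{c,b,*} + A^{ι,a,b} + B̄^{(2),ι,a,b}`
with the two double non-trivial triangles left as PARAMETERS `B2`, `Bbar2 : DirBlockFamily d`.  This module types
those two parameters from their Appendix-B tables — §5.1 Table (v2 p. 47, TeX l.9247–9257): "Double non-trivial
triangle `B^{(2),ι,a,b}(0,v,x,y)`, right: A combination of a closed triangle and an open square. All points `(u,w,y)`
of the small triangle are distinct and `u,w ∉ {0,x}`.  Double non-trivial triangle `B̄^{(2),ι,a,b}(0,v,x,y)`, left: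
A combination of a closed triangle and an open square. The small triangle is non-trivial, i.e., `w ≠ u,y` and
`x ≠ u`, and also `0 ∉ {w, w+e_ι}`" — namely
* Table "Diagrams and definition of `B^{(2),ι,a,b}(0,v,x,y)`" (`PercBoundTableBNT`, v2 p. 76, TeX l.10515–10539):
  `blockBNT₀` / `blockBNT`;
* Table "Diagram of the different cases of `B̄^{(2),ι,a,b}(0,v,x,y)`" (`PercBoundTableBNTTwoTwo`, v2 p. 77,
  TeX l.10541–10569) and its continuation (`PercBoundTableBNTTwoOne`, TeX l.10572–10584): `blockBbarNT₀` / `blockBbarNT`;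
* "We define the diagrams `B^{(2),ι,a,b}`, `B̄^{(2),ι,a,b}` for the cases of `a,b` not defined in the Tables … to be
  zero, i.e., for `b = 0,1` we let `B^{(2),ι,a,b}(0,v,x,y) = 0` and for `a = 0` we let `B̄^{(2),ι,a,b}(0,v,x,y) = 0`"
  (v2 p. 78, TeX l.10592): the zero arms (`blockBNT₀_of_val_le_one`, `blockBbarNT₀_zero_left`);
and then instantiates the composites and their §5.1 elements: `blockBFull := blockB L (blockBNT L)`,
`blockBbarFull := blockBbar L (blockBbarNT L)`, `matBNT`, `matBbarNT`, `matBiotaFull`, `matBbarIotaFull` (the notebook's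
`Matrix[B2i,s]`, `Matrix[Bbar2i,s]`, `Matrix[B,s]`, `Matrix[Bbar,s]`, [FvdHnb] Percolation.nb `In[1193]`, `In[1194]`,
`In[1200]` — a correspondence of NAMES; no equality with any notebook numeral is asserted here).

## How the two tables are typed (the rules of `NobleBlocks`, plus internal vertices)

* Every printed entry is a product of letters of the bundle `Letters d` (`τ`, `P(· ⇔ ·)`, `B`, `T`, `S`, `P` with
  "at least `m`" indices `LenIdx.ge m` and underlined "exactly `m`" indices `LenIdx.eq m`), of the factors
  `2dD(·)` (`twoDD`), `1/p` (`L.p⁻¹`), read at base point `0` with `e = e_ι = stepVec ι`; the general base point is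
  `ofBase` (translation), so every block is translation invariant by construction.
* INTERNAL VERTICES.  Both tables are headed by a picture carrying "`Σ_{u,w}`" (TeX l.6281, l.6333: the macros
  `\picBTwoPrime`, `\picBbarPrimeTwo`): the points `u, w` are summed over `ℤ^d` (`∑' u, ∑' w`), all other
  points `0, v, x, y, e_ι` are arguments.
* CASE CELLS.  As in `NobleBlocks`: an (in)equation between displayed points printed in a case cell is a Kronecker
  factor (`kd`/`kdc`), the sub-rows of one `(a,b)` cell are SUMMED, and a sub-case printed as an intrinsic-distance
  class of a line between two displayed points (`d(w,u) = 1` / `d(w,u) ≥ 2`, `d(u,y) ≥ 1`) is carried by the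
  corresponding (underlined / plain) index of the entry's letter, except that `d(u,y) ≥ 1` also gives the factor
  `u ≠ y` (`kdc u y`) that separates it from its sibling sub-row `u = y` (`kd u y`).

READINGS (recorded, not adjudicated; package DIVERGENCE.md, entry "lean1-g14 — Q-N76-2"; each is reversible in one
`match` arm):
(α) WHICH PAIR `a` AND `b` INDEX IN `B̄^{(2)}`.  App. B (v2 p. 73, TeX l.10452) and §5.1 (p. 47, l.9221) say "`a =
    d(0,v)`, `b = d(x,y)`".  The right piece `B^{(2)}` follows it (row `a = 0`: "`0 = v ≠ w`"; row `a = 1`: factor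
    `(2d)²D(v)D(w−u)`; its pictures put the pair `(0,v)` on the left with the class of the segment `0–v` equal to
    `a`, TeX l.6252–6280, l.6673–6705).  The left piece `B̄^{(2)}` is printed MIRRORED: its pictures put `(x,y)` on
    the LEFT and `(0,v)` on the RIGHT (TeX l.6307–6335), the segment `x–y` carries the class `a` ("`= 1`" in the
    `a = 1` rows, l.7221–7250; "`≥ 2`" in the `a ≥ 2` rows, l.7386–7420, l.7494–7531) and the segment `0–v` the class
    `b` (`v` absent in the `b = 0` rows, "`= 1`" on `0–v` in the `b = 1` rows, l.7494–7531); the entries agree: the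
    exactly-one index sits on the line `y → x` in every `a = 1` row (`S_{1̲,0,1,1̲}(x−y,…)`, `P_{1̲,0,1̲,0,1̲}(x−y,…)`,
    `B_{0,1̲}(x,y)`, l.10575–10583) and on the line `0 → v` in the `b = 1` row `P_{1̲,0,1̲,0,1̲}(x−y,−y,v−y,…)`
    (l.10579), while the rows `a ≥ 2` put "`2`"/"`≥`" indices on `x → y` (`S_{1̲,1,0,2}(e,−w,x−w,y−w)`, l.10546;
    `B_{0,2}(x,y)`, l.10563).  Hence in the `B̄^{(2)}` tables `a` is the class of the pair `(x,y)` and `b` the class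
    of the pair `(0,v)`: the row "`a ≥ 2, b = 0 ⇒ v = 0`" (l.10545) is consistent (no misprint), and the notebook's
    `Bound[Bbar2i,a,b,s]` (Percolation.nb In[1194]: zero for `a = 0`; `(a,1) = (a,0)/(2dz)`) is indexed the same
    way.  The tables are typed LITERALLY with the printed `(a,b)` and the printed argument slots `(0,v,x,y)`; which
    functional turns `B̄^{(2)}` / `B̄` into the element `(B̄)_{a,b}` (sup over `v` as printed in §5.1 p. 49, or over
    the other pair, package question D63 (d)) is NOT decided here — `matBbarNT`/`matBbarIotaFull` below are the printed one.
(β) Row `a = 1, b = 0` of the continued table prints "`⇒ y = u, v = w+e_ι ≠ 0`" (l.10574).  Its picture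
    (`\picBbarPrimeOneZeroTwo`, l.7221–7250) has no vertex `v` (the right pair is the single point `0`, as in every
    other `b = 0` row) and the segment `w+e_ι → 0` of class `≥ 1`; §5.1 (l.9257) requires `0 ∉ {w, w+e_ι}`.  Typed:
    `δ_{u,y} δ_{v,0} (1 − δ_{v,w+e_ι})`, i.e. "`y = u`, `v = 0`, `v ≠ w + e_ι`".  The literal alternative
    `δ_{u,y} δ_{v,w+e_ι} (1−δ_{v,0})` would make this the only `b = 0` row with `v ≠ 0`.
(γ) `P(y ⇔ w)` (l.10545, 10554, 10574, 10578, 10582) is `L.dbc (w − y)` and `P(w ⇔ y)` (l.10561) is `L.dbc (y − w)`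
    (translation of `P_p(0 ⇔ ·)`); no point case is printed in these cells (contrast `NobleBlocks` READING (d)),
    none is added.
(δ) The sub-case columns "`d(w,u) = 1` / `d(w,u) ≥ 2`" (`B^{(2)}`) and "`u = y` / `d(u,y) ≥ 1, d(w,u) = 1` /
    `d(u,y) ≥ 1, d(w,u) ≥ 2`" (`B̄^{(2)}`) are typed by the rule above: `kd u y` / `kdc u y`, the `d(w,u)` classes by
    the printed indices only (`T_{1,1,1̲}` vs `T_{1,1,2}`, `S_{1,1̲,1,0}` vs `T_{2,1,1}`).
(ε) Row `a = 0, b ≥ 2` of `B^{(2)}` prints "`0 = v ≠ w`" (l.10516): `δ_{v,0} (1 − δ_{v,w})`.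

## Main definitions
* `blockBNT₀`, `blockBNT` — `B^{(2),ι,a,b}` at base point `0` / at a general base point;
* `blockBbarNT₀`, `blockBbarNT` — `B̄^{(2),ι,a,b}`;
* `blockBFull`, `blockBbarFull` — (5.4), (5.5) with these pieces plugged in; `matBNT`, `matBbarNT`, `matBiotaFull`, `matBbarIotaFull`
  — the §5.1 elements `sup_v Σ_{ι,x,y} (·)(0,v,x,y)` of the four families.

## Main statements (all proved, kernel only)
* `isTransInv_blockBNT`, `isTransInv_blockBbarNT`, `isTransInv_blockBFull`, `isTransInv_blockBbarFull` — the
  hypothesis of `BlockSummation` / `BlockComposition` for these blocks;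
* `blockBNT₀_of_val_le_one`, `blockBbarNT₀_zero_left` — the zero cases of TeX l.10592;
* `blockBNT_zero`, `blockBbarNT_zero` — base point `0` reads back the table.

## References
* [FvdH17] R. Fitzner, R. van der Hofstad, Mean-field behavior for nearest-neighbor percolation in `d > 10`,
  Electron. J. Probab. 22 (2017) no. 43; arXiv:1506.07977v2 — §5.1 Table (p. 47) and (5.4)–(5.5) (p. 48),
  "Elements of the bounds" (p. 49), Appendix B Tables `PercBoundTableBNT`, `PercBoundTableBNTTwoTwo`,
  `PercBoundTableBNTTwoOne` and the sentence after them (pp. 76–78).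
* [FvdHnb] R. Fitzner, Mathematica notebooks accompanying [FvdH17]/[NoBLE17], `Percolation.nb` (cells
  `Bound[B2i,…]` In[1193], `Bound[Bbar2i,…]` In[1194], `Matrix[B,s]`, `Matrix[Bbar,s]` In[1200]).
-/

noncomputable section

namespace Literature.Probability.FitznerVanDerHofstad2017.NobleBlocks

open Literature.Probability.LatticeModels Literature.Probability.Percolation
open Literature.Probability.FitznerVanDerHofstad2017.BlockSummation
open scoped BigOperators ENNReal

variable {d : ℕ}

/-! ### A. The right piece `B^{(2),ι,a,b}(0,v,x,y)` — Table `PercBoundTableBNT` (v2 p. 76) -/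

/-- **`B^{(2),ι,a,b}(0,v,x,y)`** at base point `0`, `e = e_ι`, internal vertices `u, w` summed
(Table "Diagrams and definition of `B^{(2),ι,a,b}(0,v,x,y)`", v2 p. 76, TeX l.10515–10539; zero for `b = 0,1`,
l.10592):
`a = 0, b ≥ 2 (0 = v ≠ w)`: `d(w,u) = 1`: `2dD(w−u) S_{1,1̲,1,0}(w,u,x,e) T_{1,1,1̲}(u−y,w−y,0)`;
  `d(w,u) ≥ 2`: `S_{1,0,1̲,1}(x−u,e−u,−u,w−u) T_{2,1,1}(w−u,y−u,0)`;
`a = 1, b ≥ 2`: `d(u,w) = 1`: `(1/p)(2d)²D(v)D(w−u) T_{1,1,1̲}(y−u,w−u,0) P_{1̲,0,1,1̲,0}(e,x,u,w,v)`;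
  `d(u,w) ≥ 2`: `(1/p) T_{1,1,2}(y−u,w−u,0) P_{1,0,1̲,1̲,0}(x−u,e−u,−u,v−u,w−u)`;
`a ≥ 2, b ≥ 2`: `d(u,w) = 1`: `(1/p) 2dD(w−u) T_{1,1,1̲}(u−y,w−y,0) P_{1̲,0,1,1̲,0}(e,x,u,w,v)`;
  `d(u,w) ≥ 2`: `B_{1,1}(u−y,w−y) P_{1̲,0,1,2,0}(e,x,u,w,v)`.
NOTE (HOME DIVERGENCE D76; REFEREE v70 R400: reading/misprint in print, harmless to every numeral of record): rows
`(0,≥2|d=1)`, `(≥2,≥2|d=1)`, `(≥2,≥2|d≥2)` print the small-triangle letter with base point `y` where the pictures,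
the `d(w,u)`/`2dD(w−u)` data, the sibling rows and `F″` (4.60) give base point `u` (`T_{1,1,1̲}(y−u,w−u,0)`,
`B_{1,1}(y−u,w−u)`); this definition stays VERBATIM print — the typed repair is a primed additive `blockBNT'₀`.
[cite: FitznerVanDerHofstad2017, App. B Table "Diagrams and definition of B^{(2),ι,a,b}(0,v,x,y)" (arXiv:1506.07977v2 p. 76)] -/
def blockBNT₀ (L : Letters d) (ι : Fin d × Bool) (a b : Fin 3) (v x y : Site d) : ℝ≥0∞ :=
  let e : Site d := stepVec ι
  match a.val, b.val with
  | _, 0 => 0                                                                                        -- l.10592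
  | _, 1 => 0                                                                                        -- l.10592
  | 0, _ => kd v 0 * ∑' u, ∑' w, kdc v w *
            (twoDD (w - u) * L.S (.ge 1) (.eq 1) (.ge 1) (.ge 0) w u x e * L.T (.ge 1) (.ge 1) (.eq 1) (u - y) (w - y) 0
                                                                                                   -- l.10516–10519
              + L.S (.ge 1) (.ge 0) (.eq 1) (.ge 1) (x - u) (e - u) (-u) (w - u) * L.T (.ge 2) (.ge 1) (.ge 1) (w - u) (y - u) 0)
                                                                                                   -- l.10520–10522
  | 1, _ => ∑' u, ∑' w,
            (L.p⁻¹ * twoDD v * twoDD (w - u) * L.T (.ge 1) (.ge 1) (.eq 1) (y - u) (w - u) 0 *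
                L.P (.eq 1) (.ge 0) (.ge 1) (.eq 1) (.ge 0) e x u w v                               -- l.10523–10526
              + L.p⁻¹ * L.T (.ge 1) (.ge 1) (.ge 2) (y - u) (w - u) 0 *
                L.P (.ge 1) (.ge 0) (.eq 1) (.eq 1) (.ge 0) (x - u) (e - u) (-u) (v - u) (w - u))   -- l.10527–10530
  | _, _ => ∑' u, ∑' w,
            (L.p⁻¹ * twoDD (w - u) * L.T (.ge 1) (.ge 1) (.eq 1) (u - y) (w - y) 0 *
                L.P (.eq 1) (.ge 0) (.ge 1) (.eq 1) (.ge 0) e x u w v                               -- l.10531–10534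
              + L.B (.ge 1) (.ge 1) (u - y) (w - y) * L.P (.eq 1) (.ge 0) (.ge 1) (.ge 2) (.ge 0) e x u w v)
                                                                                                   -- l.10535–10538

/-- `B^{(2),ι,a,b}(u,v,x,y)` (general base point, by translation).
[cite: FitznerVanDerHofstad2017, App. B Table "Diagrams and definition of B^{(2),ι,a,b}(0,v,x,y)" (arXiv:1506.07977v2 p. 76)] -/
def blockBNT (L : Letters d) : DirBlockFamily d := fun ι a b => ofBase (blockBNT₀ L ι a b)

/-! ### B. The left piece `B̄^{(2),ι,a,b}(0,v,x,y)` — Tables `PercBoundTableBNTTwoTwo` / `…TwoOne` (v2 p. 77) -/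

/-- **`B̄^{(2),ι,a,b}(0,v,x,y)`** at base point `0`, `e = e_ι`, internal vertices `u, w` summed (Table "Diagram of
the different cases of `B̄^{(2),ι,a,b}(0,v,x,y)`" and its continuation, v2 p. 77, TeX l.10541–10584; zero for
`a = 0`, l.10592; READINGS (α)–(δ) of the module docstring — in these tables `a` is the class of `(x,y)` and `b`
the class of `(0,v)`, typed literally):
`a ≥ 2, b = 0 (⇒ v = 0)`: `u = y`: `P(y⇔w) S_{1̲,1,0,2}(e,−w,x−w,y−w)`;  `d(u,y) ≥ 1, d(w,u) = 1`:
  `(1/p) T_{1,1,1̲}(y−w,u−w,0) P_{0,1,1̲,1̲,1}(x,u,w,w+e,0)`;  `d(u,y) ≥ 1, d(w,u) ≥ 2`: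
  `T_{1,1,2}(y−w,u−w,0) S_{1̲,1,0,1}(e,−w,x−w,u−w)`;
`a ≥ 2, b = 1`: `u = y`: `(1/p) P(y⇔w) P_{1̲,0,1̲,0,2}(e,v−w,−w,x−w,y−w)`;  `d(u,y) ≥ 1, d(w,u) = 1`:
  `(2dD(v)/p) T_{1,1,1̲}(y−w,u−w,0) P_{0,1,1̲,1̲,0}(x,u,w,w+e,v)`;  `d(u,y) ≥ 1, d(w,u) ≥ 2`:
  `(2dD(v)/p) T_{1,1,2}(y−w,u−w,0) P_{1̲,0,1̲,0,1}(e,v−w,−w,x−w,u−w)`;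
`a ≥ 2, b ≥ 2`: `u = y`: `P(w⇔y) B_{1̲,0}(e,v−w) B_{0,2}(x,y)`;  `d(u,y) ≥ 1, d(w,u) = 1`:
  `(1/p) T_{1,1,1̲}(y−w,u−w,0) P_{0,1,1̲,1̲,0}(x,u,w,w+e,v)`;  `d(u,y) ≥ 1, d(w,u) ≥ 2`:
  `B_{1̲,0}(e,v−w) B_{0,1}(x,u) T_{1,1,2}(y−w,u−w,0)`;
`a = 1, b = 0 (⇒ y = u, v = 0, v ≠ w+e)`: `P(y⇔w) S_{1̲,0,1,1̲}(x−y,−y,w+e−y,w−y)`;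
`a = 1, b = 1 (⇒ y = u)`: `(1/p) P(y⇔w) P_{1̲,0,1̲,0,1̲}(x−y,−y,v−y,w+e−y,w−y)`;
`a = 1, b ≥ 2 (⇒ y = u)`: `P(y⇔w) B_{1̲,0}(e,v−w) B_{0,1̲}(x,y)`.
[cite: FitznerVanDerHofstad2017, App. B Tables "Diagram of the different cases of B̄^{(2),ι,a,b}(0,v,x,y)" and "(continued)" (arXiv:1506.07977v2 p. 77)] -/
def blockBbarNT₀ (L : Letters d) (ι : Fin d × Bool) (a b : Fin 3) (v x y : Site d) : ℝ≥0∞ :=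
  let e : Site d := stepVec ι
  match a.val, b.val with
  | 0, _ => 0                                                                                        -- l.10592
  | 1, 0 => kd v 0 * ∑' u, ∑' w, kd u y * kdc v (w + e) * L.dbc (w - y) *
              L.S (.eq 1) (.ge 0) (.ge 1) (.eq 1) (x - y) (-y) (w + e - y) (w - y)                 -- l.10574–10576
  | 1, 1 => ∑' u, ∑' w, kd u y * L.p⁻¹ * L.dbc (w - y) *
              L.P (.eq 1) (.ge 0) (.eq 1) (.ge 0) (.eq 1) (x - y) (-y) (v - y) (w + e - y) (w - y)  -- l.10577–10580
  | 1, _ => ∑' u, ∑' w, kd u y * L.dbc (w - y) * L.B (.eq 1) (.ge 0) e (v - w) * L.B (.ge 0) (.eq 1) x y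
                                                                                                   -- l.10581–10583
  | _, 0 => kd v 0 * ∑' u, ∑' w,
              (kd u y * L.dbc (w - y) * L.S (.eq 1) (.ge 1) (.ge 0) (.ge 2) e (-w) (x - w) (y - w) -- l.10545–10548
                + kdc u y * (L.p⁻¹ * L.T (.ge 1) (.ge 1) (.eq 1) (y - w) (u - w) 0 *
                    L.P (.ge 0) (.ge 1) (.eq 1) (.eq 1) (.ge 1) x u w (w + e) 0)                   -- l.10549–10550
                + kdc u y * (L.T (.ge 1) (.ge 1) (.ge 2) (y - w) (u - w) 0 *
                    L.S (.eq 1) (.ge 1) (.ge 0) (.ge 1) e (-w) (x - w) (u - w)))                    -- l.10551–10552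
  | _, 1 => ∑' u, ∑' w,
              (kd u y * L.p⁻¹ * L.dbc (w - y) *
                  L.P (.eq 1) (.ge 0) (.eq 1) (.ge 0) (.ge 2) e (v - w) (-w) (x - w) (y - w)       -- l.10553–10556
                + kdc u y * (twoDD v * L.p⁻¹ * L.T (.ge 1) (.ge 1) (.eq 1) (y - w) (u - w) 0 *
                    L.P (.ge 0) (.ge 1) (.eq 1) (.eq 1) (.ge 0) x u w (w + e) v)                   -- l.10557–10558
                + kdc u y * (twoDD v * L.p⁻¹ * L.T (.ge 1) (.ge 1) (.ge 2) (y - w) (u - w) 0 *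
                    L.P (.eq 1) (.ge 0) (.eq 1) (.ge 0) (.ge 1) e (v - w) (-w) (x - w) (u - w)))    -- l.10559–10560
  | _, _ => ∑' u, ∑' w,
              (kd u y * L.dbc (y - w) * L.B (.eq 1) (.ge 0) e (v - w) * L.B (.ge 0) (.ge 2) x y    -- l.10561–10563
                + kdc u y * (L.p⁻¹ * L.T (.ge 1) (.ge 1) (.eq 1) (y - w) (u - w) 0 *
                    L.P (.ge 0) (.ge 1) (.eq 1) (.eq 1) (.ge 0) x u w (w + e) v)                   -- l.10564–10566
                + kdc u y * (L.B (.eq 1) (.ge 0) e (v - w) * L.B (.ge 0) (.ge 1) x u *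
                    L.T (.ge 1) (.ge 1) (.ge 2) (y - w) (u - w) 0))                                 -- l.10567–10569

/-- `B̄^{(2),ι,a,b}(u,v,x,y)` (general base point, by translation).
[cite: FitznerVanDerHofstad2017, App. B Tables "Diagram of the different cases of B̄^{(2),ι,a,b}(0,v,x,y)" (arXiv:1506.07977v2 p. 77)] -/
def blockBbarNT (L : Letters d) : DirBlockFamily d := fun ι a b => ofBase (blockBbarNT₀ L ι a b)

/-! ### C. Zero cases, base point, translation invariance -/

/-- "for `b = 0,1` we let `B^{(2),ι,a,b}(0,v,x,y) = 0`". [cite: FitznerVanDerHofstad2017, App. B, sentence after the B̄^{(2)} tables (arXiv:1506.07977v2 p. 78)] -/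
theorem blockBNT₀_of_val_le_one (L : Letters d) (ι : Fin d × Bool) (a : Fin 3) {b : Fin 3} (hb : b.val ≤ 1)
    (v x y : Site d) : blockBNT₀ L ι a b v x y = 0 := by
  unfold blockBNT₀
  rcases b with ⟨_ | _ | m, hb'⟩
  · rcases a with ⟨_ | _ | _ | n, ha⟩
    · rfl
    · rfl
    · rfl
    · exfalso; omega
  · rcases a with ⟨_ | _ | _ | n, ha⟩
    · rfl
    · rfl
    · rfl
    · exfalso; omega
  · exfalso; change m + 1 + 1 ≤ 1 at hb; omega

/-- "for `a = 0` we let `B̄^{(2),ι,a,b}(0,v,x,y) = 0`". [cite: FitznerVanDerHofstad2017, App. B, sentence after the B̄^{(2)} tables (arXiv:1506.07977v2 p. 78)] -/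
theorem blockBbarNT₀_zero_left (L : Letters d) (ι : Fin d × Bool) (b : Fin 3) (v x y : Site d) :
    blockBbarNT₀ L ι 0 b v x y = 0 := by
  unfold blockBbarNT₀
  rcases b with ⟨_ | _ | _ | m, hb⟩
  · rfl
  · rfl
  · rfl
  · exfalso; omega

/-- `B^{(2),ι,a,b}(0,v,x,y)` is the table entry. [folklore] -/
@[simp] theorem blockBNT_zero (L : Letters d) (ι : Fin d × Bool) (a b : Fin 3) (v x y : Site d) :
    blockBNT L ι a b 0 v x y = blockBNT₀ L ι a b v x y := ofBase_zero _ _ _ _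

/-- `B̄^{(2),ι,a,b}(0,v,x,y)` is the table entry. [folklore] -/
@[simp] theorem blockBbarNT_zero (L : Letters d) (ι : Fin d × Bool) (a b : Fin 3) (v x y : Site d) :
    blockBbarNT L ι a b 0 v x y = blockBbarNT₀ L ι a b v x y := ofBase_zero _ _ _ _

/-- `B^{(2),ι,a,b}` is translation invariant. [folklore] -/
theorem isTransInv_blockBNT (L : Letters d) (ι : Fin d × Bool) (a b : Fin 3) :
    IsTransInv (blockBNT L ι a b) := isTransInv_ofBase _

/-- `B̄^{(2),ι,a,b}` is translation invariant. [folklore] -/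
theorem isTransInv_blockBbarNT (L : Letters d) (ι : Fin d × Bool) (a b : Fin 3) :
    IsTransInv (blockBbarNT L ι a b) := isTransInv_ofBase _

/-- `B^{(2)}` vanishes for `b = 0, 1` at every base point. [cite: FitznerVanDerHofstad2017, App. B, sentence after the B̄^{(2)} tables (arXiv:1506.07977v2 p. 78)] -/
theorem blockBNT_of_val_le_one (L : Letters d) (ι : Fin d × Bool) (a : Fin 3) {b : Fin 3} (hb : b.val ≤ 1)
    (t v x y : Site d) : blockBNT L ι a b t v x y = 0 := by
  simp only [blockBNT, ofBase, blockBNT₀_of_val_le_one L ι a hb]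

/-- `B̄^{(2)}` vanishes for `a = 0` at every base point. [cite: FitznerVanDerHofstad2017, App. B, sentence after the B̄^{(2)} tables (arXiv:1506.07977v2 p. 78)] -/
theorem blockBbarNT_zero_left (L : Letters d) (ι : Fin d × Bool) (b : Fin 3) (t v x y : Site d) :
    blockBbarNT L ι 0 b t v x y = 0 := by
  simp only [blockBbarNT, ofBase, blockBbarNT₀_zero_left]

/-! ### D. The composites (5.4)–(5.5) with the pieces plugged in, and their elements -/

/-- **`B^{ι,a,b}`** of (5.4) with the typed right piece: `blockB L (blockBNT L)`.
[cite: FitznerVanDerHofstad2017, §5.1 (5.4) (arXiv:1506.07977v2 p. 48)] -/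
def blockBFull (L : Letters d) : DirBlockFamily d := blockB L (blockBNT L)

/-- **`B̄^{ι,a,b}`** of (5.5) with the typed left piece: `blockBbar L (blockBbarNT L)`.
[cite: FitznerVanDerHofstad2017, §5.1 (5.5) (arXiv:1506.07977v2 p. 48)] -/
def blockBbarFull (L : Letters d) : DirBlockFamily d := blockBbar L (blockBbarNT L)

/-- `B^{ι,a,b}` (pieces plugged in) is translation invariant. [folklore] -/
theorem isTransInv_blockBFull (L : Letters d) (ι : Fin d × Bool) (a b : Fin 3) : IsTransInv (blockBFull L ι a b) :=
  isTransInv_blockB L (isTransInv_blockBNT L) ι a b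

/-- `B̄^{ι,a,b}` (pieces plugged in) is translation invariant. [folklore] -/
theorem isTransInv_blockBbarFull (L : Letters d) (ι : Fin d × Bool) (a b : Fin 3) :
    IsTransInv (blockBbarFull L ι a b) :=
  isTransInv_blockBbar L (isTransInv_blockBbarNT L) ι a b

/-- `(B^{(2)})_{a,b} = sup_v Σ_{ι,x,y} B^{(2),ι,a,b}(0,v,x,y)` — the element of the right piece in the §5.1 form
(the name `Matrix[B2i,s]` of [FvdHnb]). [cite: FitznerVanDerHofstad2017, §5.1 "Elements of the bounds" (arXiv:1506.07977v2 p. 49)] -/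
def matBNT (L : Letters d) : Matrix (Fin 3) (Fin 3) ℝ≥0∞ := matB (blockBNT L)

/-- `(B̄^{(2)})_{a,b} = sup_v Σ_{ι,x,y} B̄^{(2),ι,a,b}(0,v,x,y)` — the printed functional (READING (α): the
question which pair the supremum runs over for the left pieces is package question D63 (d), not decided here;
the name `Matrix[Bbar2i,s]` of [FvdHnb]). [cite: FitznerVanDerHofstad2017, §5.1 "Elements of the bounds" (arXiv:1506.07977v2 p. 49)] -/
def matBbarNT (L : Letters d) : Matrix (Fin 3) (Fin 3) ℝ≥0∞ := matB (blockBbarNT L)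

/-- `(B)_{a,b} = sup_v Σ_{ι,x,y} B^{ι,a,b}(0,v,x,y)` with the typed pieces (`Matrix[B,s]` of [FvdHnb]).
[cite: FitznerVanDerHofstad2017, §5.1 "Elements of the bounds" (arXiv:1506.07977v2 p. 49)] -/
def matBiotaFull (L : Letters d) : Matrix (Fin 3) (Fin 3) ℝ≥0∞ := matBiota L (blockBNT L)

/-- `(B̄)_{a,b} = sup_v Σ_{ι,x,y} B̄^{ι,a,b}(0,v,x,y)` with the typed pieces, printed functional (`Matrix[Bbar,s]`
of [FvdHnb]; READING (α), D63 (d)). [cite: FitznerVanDerHofstad2017, §5.1 "Elements of the bounds" (arXiv:1506.07977v2 p. 49)] -/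
def matBbarIotaFull (L : Letters d) : Matrix (Fin 3) (Fin 3) ℝ≥0∞ := matBbarIota L (blockBbarNT L)

/-- `matBiotaFull` unfolds to the element of `blockB` with the typed piece. [folklore] -/
theorem matBiotaFull_eq (L : Letters d) : matBiotaFull L = matB (blockB L (blockBNT L)) := rfl

/-- `matBbarIotaFull` unfolds to the element of `blockBbar` with the typed piece. [folklore] -/
theorem matBbarIotaFull_eq (L : Letters d) : matBbarIotaFull L = matB (blockBbar L (blockBbarNT L)) := rfl

/-! ### E. Reading back single rows (regression checks of the transcription) -/

/-- Row `a ≥ 2, b ≥ 2` of the `B^{(2)}` table. [cite: FitznerVanDerHofstad2017, App. B Table "definition of B^{(2),ι,a,b}(0,v,x,y)", last row (arXiv:1506.07977v2 p. 76)] -/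
theorem blockBNT₀_two_two (L : Letters d) (ι : Fin d × Bool) (v x y : Site d) :
    blockBNT₀ L ι 2 2 v x y = ∑' u, ∑' w,
      (L.p⁻¹ * twoDD (w - u) * L.T (.ge 1) (.ge 1) (.eq 1) (u - y) (w - y) 0 *
          L.P (.eq 1) (.ge 0) (.ge 1) (.eq 1) (.ge 0) (stepVec ι) x u w v
        + L.B (.ge 1) (.ge 1) (u - y) (w - y) * L.P (.eq 1) (.ge 0) (.ge 1) (.ge 2) (.ge 0) (stepVec ι) x u w v) := rfl

/-- Row `a = 1, b ≥ 2` of the continued `B̄^{(2)}` table: `Σ_{u,w} δ_{u,y} P(y⇔w) B_{1̲,0}(e,v−w) B_{0,1̲}(x,y)`.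
[cite: FitznerVanDerHofstad2017, App. B Table "different cases of B̄^{(2),ι,a,b}(0,v,x,y) (continued)", last row (arXiv:1506.07977v2 p. 77)] -/
theorem blockBbarNT₀_one_two (L : Letters d) (ι : Fin d × Bool) (v x y : Site d) :
    blockBbarNT₀ L ι 1 2 v x y = ∑' u, ∑' w,
      kd u y * L.dbc (w - y) * L.B (.eq 1) (.ge 0) (stepVec ι) (v - w) * L.B (.ge 0) (.eq 1) x y := rfl

/-- Row `a ≥ 2, b = 0` of the `B̄^{(2)}` table carries `δ_{v,0}` ("`⇒ v = 0`"): it vanishes off `v = 0`.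
[cite: FitznerVanDerHofstad2017, App. B Table "different cases of B̄^{(2),ι,a,b}(0,v,x,y)", first row (arXiv:1506.07977v2 p. 77)] -/
theorem blockBbarNT₀_two_zero_of_ne (L : Letters d) (ι : Fin d × Bool) {v : Site d} (hv : v ≠ 0) (x y : Site d) :
    blockBbarNT₀ L ι 2 0 v x y = 0 := by
  show kd v 0 * _ = 0
  rw [kd_of_ne hv, zero_mul]

end Literature.Probability.FitznerVanDerHofstad2017.NobleBlocks

end
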